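import Literature.MathematicalPhysics.QuantumFieldTheory.Dimock2011to13.QED3SingularWalkBound
import HarnessLib

/-!
# Dimock, *Quantum electrodynamics on the 3-torus II*, §3.2 THEOREM 1 ASSEMBLED: from the partition of unity (125), the
# local inverses (136)–(137) and the commutator bound (143), the random walk expansion (132) ∕ (141)–(142) CONVERGES
# ENTRY BY ENTRY, its sum IS the inverse `S_{k,Λ}(A) = [D_{e_k}(A) + m_k + Q_{k,Λ}(−A)ᵀbQ_{k,Λ}(A)]^{−1}_{L^{−k}Λ_0}` of
# (119), and it obeys (135) — PROVED for the lattice operators (matrices), multiscale member, every `O(1)` explicit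

statement-level skeleton of published theorems with citation tags; proofs where landed; nothing here is a claim about the Yang–Mills mass gap

(Writer seat p11 = literature-prover-lit-balaban-p11-g22-0; YM LIT SWEEP item (c), Lean lane — zero weight for the
YM-INPRINT tokens of row C13.)

**Citation header (reproduction of PUBLISHED work).** J. Dimock, *Quantum electrodynamics on the 3-torus II. The RG
flow*, arXiv:math-ph/0407063v1 (2004) [Dimock2004QED3TorusII], §3.2 «fermions», THEOREM 1 p.22 with its proof Parts I
and III pp.23–25; `p.NN Lnn` = PDF page ∕ line of the held text layer `paper:arxiv-math-ph_0407063`.  The algebra of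
Part I is the tree's `RandomWalkExpansion` (Dimock's own later rendering [Dimock2013] §2.4: `Gstar`, `Kop`, `Kz`,
`walkTerm`, `Kop_pow`, `Gstar_mul_Kop_pow`), the estimate of Part III is the tree's two-profile engine
`QED3SingularWalkBound.dimock195` and the path count `QED3SingularWalkBound.card_walks_le` — all used BY NAME; this file supplies the assembly the paper states in one breath: *"Then `S_{k,Λ}(A,x,y)` exists and has the random
walk expansion (132)"* with (135).

**What the paper prints (verbatim, text layer).**
* p.22 L2–11, (132): *"The random walk expansion for `S_{k,Λ}(A,x,y)` has the form `S_{k,Λ}(A,x,y) = Σ_{ω:x→y}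
  S_{k,Λ,ω}(A,x,y)` (132) Here we are summing over paths `ω` each of which is a sequence of adjacent cubes (blocks)
  `□_0,…,□_n` from `D`. … the adjacency condition is that `□_j, □_{j+1}` should touch, possibly only on corners, and
  including the possibility `□_j = □_{j+1}`. The notation `ω : x → y` means `x ∈ □̃_0`, `y ∈ □̃_n`."*
* p.22 L12–21, THEOREM 1: *"Let `A` satisfy `|∂A| ≤ CL^{3(k−i)∕2}p(e_i)` on `δΛ^{(k)}_i` (133) … Let `M₀` be sufficiently
  large and let `e_k` be sufficiently small. Then `S_{k,Λ}(A,x,y)` exists and has the random walk expansion (132). We have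
  the bound for each path `|S_{k,Λ,ω}(A,x,y)| ≤ O(1)(O(1)M₀^{−1})^{|ω|}d′(x,y)^{−2}exp(−O(1)d_Λ(x,y))` (134) and the bound
  for the full propagator `|S_{k,Λ}(A,x,y)| ≤ O(1)d′(x,y)^{−2}exp(−O(1)d_Λ(x,y))` (135)"*.
* p.23 L1–31, PART I: *"We define a parametrix on `L^{−k}Λ_0` `S*(A) = Σ_{□∈D}h_□S*_□(A)h_□` (138) Then thanks to (125)
  and (136) `(D_{e_k}(A) + m_k + Q_{k,Λ}(−A)ᵀbQ_{k,Λ}(A))S*(A) = I − Σ_□R_□(A)S*_□(A)h_□ ≡ I − R` (139) where `R_□(A) =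
  −[(D_{e_k}(A) + m_k + Q_{k,Λ}(−A)ᵀbQ_{k,Λ}(A)), h_□]` (140) The inverse is now `S_{k,Λ}(A) = S*(A)(I − R)^{−1} =
  S*(A)Σ_{n=0}^∞R^n` (141) provided the series converges. This can also be written `S_{k,Λ}(A) = Σ_{n=0}^∞Σ_{□_0,□_1,…,□_n}
  (h_{□_0}S*_{□_0}(A)h_{□_0})(R_{□_1}(A)S*_{□_1}(A)h_{□_1})⋯(R_{□_n}(A)S*_{□_n}(A)h_{□_n}) ≡ Σ_ωS_{k,Λ,ω}(A)` (142) In the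
  last step we identify the random walk expansion by noting that the term vanishes unless all pairs `□_j, □_{j+1}` are
  adjacent. The kernel `S_{k,Λ,ω}(A,x,y)` vanishes unless `x ∈ supp h_{□_0} ⊂ □̃_0`"*.
* p.25 L10–12, end of PART III: *"These estimates yield the bound on `S_{k,Λ,ω}(A,x,y)`. For the bound on `S_{k,Λ}(A,x,y)`
  we sum over paths. The factor `(O(1)M₀)^{−n}` is sufficient to control the sum if `M₀` is sufficiently large."*

**What is formalized (kernel-checked, zero `sorry`; Mathlib + the tree).**  The MEMBER: the operators on `L^{−k}Λ_0` are
square matrices over a finite site type `X` with entries in a real normed algebra `E` (spinor blocks; `E` complete for the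
sums): `A` = `D_{e_k}(A) + m_k + Q_{k,Λ}(−A)ᵀbQ_{k,Λ}(A)`, `H □` = multiplication by `h_□`, `G □` = `S*_□(A)`, cubes `□ ∈ Z`
(finite).  Entries of operator products are the tree's `pathKernel` with weight `1` (the lattice weight `L^{−3k}` of `∫`
sits inside the entries).  Geometry as in the tree's `dimock195`: blocks `blk : X → B` with centres within `r`, an abstract
distance `d` (`d_Λ`), a FIRST-LINK profile `P₀` ((137): `d′^{−2}`; for THEOREM 2, (198): `d′^{−1}`) and a LATER-LINK
profile `Q` ((143): `L^{k−i}d′^{−2}` with the factor attached to the block of the left variable; (201):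
`L^{2(k−i)}d′^{−1} + L^{k−i}d′^{−2}`), the block convolution bounds `Σ_ΔQQ ≤ θQ` ∕ `Σ_ΔP₀Q ≤ θP₀` ((154); (202) ∕ (203))
and the one-point sum `K` of (155) — so THEOREM 2 (bosons, (194)–(195)) is the same theorem with other profiles.
* §1 **(139) from (125) + (136)** — `op_mul_Gstar`: `Σ_□h_□² = 1` and `h_□·A·S*_□ = h_□` (the printed (136): `AS*_□f = f`
  on `□̃ ⊇ supp h_□`) give `A·S* = 1 − R` with the tree's `Gstar`∕`Kop` (`Kz A H □ = h_□A − Ah_□ = R_□` of (140)); the link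
  operators `link0 = h_□S*_□h_□`, `linkR = R_□S*_□h_□` (`walkTerm_eq`, `walkTail_eq`); **junction vanishing**
  `link0_mul_linkR_eq_zero`, `linkR_mul_linkR_eq_zero`, `tailProd_eq_zero` (*"the term vanishes unless all pairs
  `□_j, □_{j+1}` are adjacent"* — from `h_□R_{□′} = 0` for non-adjacent cubes, every junction, by induction on the chain).
* §2 **entries of chains** — `chainLinks`, `mul_listProd_apply`: `(M₀·M_1⋯M_n)(x,y) = pathKernel 1 (links) n x y`.
* §3 **the path terms** — `chainProd` (= `walkTerm` of the tree, `walkTerm_eq_chainProd`), `chainProd_eq_zero_of_not_adj`,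
  `chainProd_apply_eq_zero_of_row` (*"vanishes unless `x ∈ supp h_{□_0}`"*), **`norm_chainProd_apply_le`** = (134) for
  every path from the link bounds (137)-shape `‖(h_□S*_□h_□)(u,v)‖ ≤ C₀P₀(u,v)e^{−cd(u,v)}` and (143)-shape
  `‖(R_□S*_□h_□)(u,v)‖ ≤ (C₁∕M₀)Q(u,v)e^{−cd(u,v)}` (via `dimock195`), `norm_tailProd_apply_le` (the same for the tails
  of `R^N`, profile `Q` throughout).
* §4 **THEOREM 1 assembled** — `mul_tsum_eq_one_of_entrywise` (generic: `A·G_s = 1 − K`, `Σ_nG_sK^n` entrywise summable,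
  `K^N → 0` entrywise ⟹ `A·(Σ'_nG_sK^n) = 1`; `inv_eq_tsum_of_entrywise`: two-sided and `= A^{−1}` for commutative `E`);
  `gstar_mul_kop_pow_apply` ((142): `(S*R^n)(x,y) = Σ_{(□_0,…,□_n)}S_ω(x,y)` over ALL sequences), `kop_pow_succ_apply`;
  **`norm_gstar_mul_kop_pow_apply_le`** (*"we sum over paths"*: with `≤ ν` start cubes at `x` and `≤ ν` cubes adjacent to
  any cube, `‖(S*R^n)(x,y)‖ ≤ ν^{n+1}C₀e^{3cr}(C₁θKe^{2cr}∕M₀)^nP₀(x,y)e^{−(c∕2)d(x,y)}` — `card_walks_le` BY NAME),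
  **`norm_kop_pow_succ_apply_le`** (`‖R^{m+1}(x,y)‖ ≤ ν^{m+1}(C₁∕M₀)e^{3cr}(…)^mQ e^{−(c∕2)d}`); `walkExpansion A H G :=
  (Σ'_n(S*R^n)(x,y))_{x,y}`; **`dimock_thm1`**: under *"`M₀` sufficiently large"* = `2ν·C₁θKe^{2cr} ≤ M₀`: (i) every
  entry series converges (absolutely), (ii) `A·S_{k,Λ}(A) = 1` — *"`S_{k,Λ}(A,x,y)` exists"*, (iii) **(135)**
  `‖S_{k,Λ}(A;x,y)‖ ≤ 2νC₀e^{3cr}·P₀(x,y)e^{−(c∕2)d(x,y)}`; **`dimock_thm1_comm`** (commutative `E`, e.g. spinor indices in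
  `X`): also `S_{k,Λ}(A)·A = 1` and `A^{−1} = S_{k,Λ}(A)` — (119); `profiles_of_scaled` (THEOREM 1's own profiles `P₀ = P`
  of `d′^{−2}`-type, `Q = lam(Δ_u)·P`, both block bounds from the scaled (154)).
* §5 **gauge covariance** (p.22 L22–23, p.23 L32–34) — `gconj U Ui a = UaU⁻¹` and its algebra; `Kz_gconj` (`R_□` covariant
  when `h_□` commutes with `U`), `link0_gconj`, `linkR_gconj`, **`walkTerm_gconj`** (each `S_{k,Λ,ω}(A)` covariant given
  `S*_□(UAU⁻¹) = US*_□(A)U⁻¹`), `Gstar_gconj`, `Kop_gconj`, `Gstar_mul_Kop_pow_gconj`, **`walkExpansion_gconj`**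
  (`S_{k,Λ}(UAU⁻¹) = US_{k,Λ}(A)U⁻¹`).

**Readings ∕ located items (declared).**  (i) (136) is used in the operator form `h_□AS*_□ = h_□` (the printed
`(AS*_□f)(x) = f(x)` for `x ∈ □̃`, and `supp h_□ ⊂ □̃`, (126)); (125) as `Σ_□h_□² = 1` with the `h_□` any pairwise commuting
or not — only the displayed identity is used.  (ii) ADJACENCY is an abstract decidable relation with `h_□R_{□′} = 0` for
non-adjacent cubes (p.23 L29–31; from `supp h_□ ⊂ □̃` and `R_{□′}` supported near `supp h_{□′}`) and `≤ ν` neighbours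
(`ν = 27`); the start cubes of `x` (`link0 … x · ≠ 0 ⟹ □ ∈ S₀x`, `≤ ν` of them) and of the `R`-links (`S₁`) likewise.
(iii) MULTISCALE BY POSITION: the factor `L^{k−i_j}` of (143) ∕ (153) is carried inside the later-link profile `Q`
(e.g. `Q(u,v) = lam(Δ_u)P(u,v)`, `profiles_of_scaled`; the sibling file `QED3BackgroundFieldSeries` discharges the scaled
(154) on `ℤ³` uniformly in the scale).  (iv) «`M₀` sufficiently large» = the number `2νC₁θKe^{2cr}`;
«`e_k` sufficiently small» enters only through LEMMA 2 (hypotheses (136)–(137)).  (v) The sum over `n` in (141) ∕ (142)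
is the entrywise `tsum`; absolute convergence entry by entry is what (134) + the path count give (no operator-norm
statement is made or needed).

**HONEST SCOPE ∕ what is NOT claimed.**  LEMMA 2 ((136)–(137): existence and bounds of the local inverses `S*_□(A)`) and
PART II ((143)–(151): the commutator bound) are HYPOTHESES in their printed shape (`h136`, `h0`, `hR`); the partition of
unity (124)–(125), the cubes `D` and the multi-region geometry (120)–(127), the support facts behind the adjacency and
start-cube hypotheses, (154) ∕ (155) ∕ (202) ∕ (203) beyond the abstract `hconv` ∕ `hconv₀` ∕ `K` (lattice members:
`QED3SingularWalkBound.hconv_Z3(_boson)`, the sibling `QED3BackgroundFieldSeries.dimock154_L`,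
`RandomWalkExpansion.sum_exp_chain_le`) are not constructed here.  Gauge covariance (§5) is proved from the covariance of `S*_□(A)` (LEMMA 2, a hypothesis)
and of the operator (`A ↦ UAU⁻¹` with `h_□` commuting with `U`) — the covariance of `D_{e_k}(A)`, `Q_{k,Λ}(A)` themselves
((42)) is the tree's `FermionBlockRGFluctuation` business and is not restated; the `A`-dependence clause of THEOREM 1
(«depends on `A` only in `⋃_{□∈ω}□^{(5)}`»), THEOREM 2 ∕ LEMMA 3 (bosons) and COROLLARY 1's analyticity are not touched.  NOT a statement about the ultraviolet problem in `d = 4`; NOT a claim about any Bałaban paper.  Unit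
`lit-balaban-p11-g22`, HOME `run/shared/lean/pub/lit-balaban/`, 2026-08-22.
-/

noncomputable section

open Finset Real Filter

namespace Literature.MathematicalPhysics.QuantumFieldTheory.Dimock2011to13

namespace QED3TorusII

open RandomWalkExpansion (Kz Gstar Kop walkTail walkTerm Kop_pow Gstar_mul_Kop_pow)

/-! ## §1 (139): the parametrix identity from (125) and (136) -/

section Algebra139

variable {R : Type*} [Ring R] {Z : Type*}

/-- **(139) from (125) and (136)**: in any ring, if `Σ_□h_□h_□ = 1` ((125)) and `h_□·A·S*_□ = h_□` ((136) on
`supp h_□ ⊂ □̃`), then `A·S*(A) = 1 − R` with `S* = Σ_□h_□S*_□h_□` (the tree's `Gstar`) and `R = Σ_□R_□S*_□h_□`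
(the tree's `Kop`, `R_□ = Kz A H □ = h_□A − Ah_□ = −[A,h_□]`, (140)) — *"Then thanks to (125) and (136) … ≡ I − R"*.
[cite: Dimock2004QED3TorusII, §3.2 Thm 1 proof Part I (138)–(140) p.23 L3–25] -/
theorem op_mul_Gstar [Fintype Z] {A : R} {H G : Z → R} (hsum : ∑ z, H z * H z = 1)
    (h136 : ∀ z, H z * A * G z = H z) : A * Gstar H G = 1 - Kop A H G := by
  unfold Gstar Kop Kz
  rw [mul_sum, ← hsum, ← sum_sub_distrib]
  refine sum_congr rfl fun z _ => ?_
  calc A * (H z * G z * H z) = A * H z * G z * H z := by simp only [mul_assoc]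
    _ = H z * H z - (H z * H z - A * H z * G z * H z) := by rw [sub_sub_cancel]
    _ = H z * H z - (H z * A * G z * H z - A * H z * G z * H z) := by rw [h136]
    _ = H z * H z - (H z * A - A * H z) * G z * H z := by simp only [sub_mul]

/-- the tree's formulation of the same input ([Dimock2013] §2.4: locality `h_zA = h_zA_z` and a GLOBAL inverse
`A_zG_z = 1` of a local version `A_z`) implies the (136)-form `h_□·A·S*_□ = h_□` used here.
[cite: Dimock2004QED3TorusII, §3.2 Lemma 2 (136) p.22 L32–42] -/
theorem h136_of_loc_inv {A : R} {H Aloc G : Z → R} (hloc : ∀ z, H z * A = H z * Aloc z)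
    (hinv : ∀ z, Aloc z * G z = 1) (z : Z) : H z * A * G z = H z := by
  rw [hloc z, mul_assoc, hinv z, mul_one]

/-- the first link operator of a path, `h_□S*_□(A)h_□`. [cite: Dimock2004QED3TorusII, §3.2 Thm 1 proof Part I (142) p.23 L31–40] -/
def link0 (H G : Z → R) (z : Z) : R := H z * G z * H z
/-- the later link operators of a path, `R_□(A)S*_□(A)h_□`. [cite: Dimock2004QED3TorusII, §3.2 Thm 1 proof Part I (142) p.23 L31–40] -/
def linkR (A : R) (H G : Z → R) (z : Z) : R := Kz A H z * G z * H z

/-- the tree's `walkTerm` is `link0` followed by the ordered product of `linkR`s. [cite: Dimock2004QED3TorusII, §3.2 Thm 1 proof Part I (142) p.23 L31–40] -/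
theorem walkTerm_eq (A : R) (H G : Z → R) (z₀ : Z) {n : ℕ} (ω : Fin n → Z) :
    walkTerm A H G z₀ ω = link0 H G z₀ * (List.ofFn fun j => linkR A H G (ω j)).prod := rfl

/-- the tree's `walkTail` (the terms of `R^n`) is the ordered product of `linkR`s. [cite: Dimock2004QED3TorusII, §3.2 Thm 1 proof Part I (141)–(142) p.23 L26–40] -/
theorem walkTail_eq (A : R) (H G : Z → R) {n : ℕ} (ω : Fin n → Z) :
    walkTail A H G ω = (List.ofFn fun j => linkR A H G (ω j)).prod := rfl

/-- **a broken first junction kills the path**: `h_{□_0}R_{□_1} = 0` ⟹ `(h_{□_0}S*_{□_0}h_{□_0})(R_{□_1}S*_{□_1}h_{□_1}) = 0`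
(*"the term vanishes unless all pairs `□_j, □_{j+1}` are adjacent"*). [cite: Dimock2004QED3TorusII, §3.2 Thm 1 proof Part I p.23 L29–31] -/
theorem link0_mul_linkR_eq_zero {A : R} {H G : Z → R} {z z' : Z} (h : H z * Kz A H z' = 0) :
    link0 H G z * linkR A H G z' = 0 := by
  unfold link0 linkR
  calc H z * G z * H z * (Kz A H z' * G z' * H z')
      = H z * G z * (H z * Kz A H z') * G z' * H z' := by simp only [mul_assoc]
    _ = 0 := by rw [h]; simp

/-- **a broken later junction kills the path**: `h_{□_j}R_{□_{j+1}} = 0` ⟹ `(R_{□_j}S*_{□_j}h_{□_j})(R_{□_{j+1}}S*_{□_{j+1}}h_{□_{j+1}}) = 0`.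
[cite: Dimock2004QED3TorusII, §3.2 Thm 1 proof Part I p.23 L29–31] -/
theorem linkR_mul_linkR_eq_zero {A : R} {H G : Z → R} {z z' : Z} (h : H z * Kz A H z' = 0) :
    linkR A H G z * linkR A H G z' = 0 := by
  unfold linkR
  calc Kz A H z * G z * H z * (Kz A H z' * G z' * H z')
      = Kz A H z * G z * (H z * Kz A H z') * G z' * H z' := by simp only [mul_assoc]
    _ = 0 := by rw [h]; simp

/-- **a chain of `R`-links with a non-adjacent consecutive pair vanishes** (induction along the chain; `adj` any relation with
`h_□R_{□′} = 0` off it). [cite: Dimock2004QED3TorusII, §3.2 Thm 1 proof Part I p.23 L29–31] -/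
theorem tailProd_eq_zero (A : R) (H G : Z → R) (adj : Z → Z → Prop)
    (hadj : ∀ z z', ¬ adj z z' → H z * Kz A H z' = 0) :
    ∀ (n : ℕ) (ω : Fin (n + 1) → Z), (¬ ∀ j : Fin n, adj (ω j.castSucc) (ω j.succ)) →
      (List.ofFn fun j => linkR A H G (ω j)).prod = 0
  | 0, ω, hω => by
      exfalso; exact hω fun j => Fin.elim0 j
  | n + 1, ω, hω => by
      rw [List.ofFn_succ, List.prod_cons]
      by_cases h0 : adj (ω (0 : Fin (n + 1)).castSucc) (ω (0 : Fin (n + 1)).succ)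
      · -- the broken junction is further down
        have htail : ¬ ∀ j : Fin n, adj ((fun i : Fin (n + 1) => ω i.succ) j.castSucc)
            ((fun i : Fin (n + 1) => ω i.succ) j.succ) := by
          intro hall
          apply hω
          intro j
          refine Fin.cases ?_ (fun j' => ?_) j
          · exact h0
          · show adj (ω j'.succ.castSucc) (ω j'.succ.succ)
            rw [← Fin.succ_castSucc]
            exact hall j'
        rw [tailProd_eq_zero A H G adj hadj n (fun i => ω i.succ) htail, mul_zero]
      · -- broken at the first junction
        have hz : linkR A H G (ω 0) * linkR A H G ((fun i : Fin (n + 1) => ω i.succ) 0) = 0 :=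
          linkR_mul_linkR_eq_zero (hadj _ _ (by rwa [Fin.castSucc_zero] at h0))
        rw [List.ofFn_succ, List.prod_cons, ← mul_assoc, hz, zero_mul]

end Algebra139

/-! ## §2 Entries of operator chains are `pathKernel`s (weight 1) -/

section Entries

variable {X : Type*} {E : Type*} [NormedRing E]

/-- the links of an operator chain `M₀·M_1⋯M_n` as an `ℕ`-indexed family of kernels (entries; zero beyond the chain) —
the input format of the tree's `pathKernel`. [cite: Dimock2004QED3TorusII, §3.2 Thm 1 proof Part III (152) p.24 L59–75] -/
def chainLinks (M₀ : Matrix X X E) {n : ℕ} (M : Fin n → Matrix X X E) : ℕ → X → X → E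
  | 0 => fun u v => M₀ u v
  | j + 1 => fun u v => if h : j < n then M ⟨j, h⟩ u v else 0

/-- the first link. [cite: Dimock2004QED3TorusII, §3.2 Thm 1 proof Part III (152) p.24 L59–75] -/
theorem chainLinks_zero (M₀ : Matrix X X E) {n : ℕ} (M : Fin n → Matrix X X E) :
    chainLinks M₀ M 0 = fun u v => M₀ u v := rfl

/-- the later links inside the chain. [cite: Dimock2004QED3TorusII, §3.2 Thm 1 proof Part III (152) p.24 L59–75] -/
theorem chainLinks_succ_of_lt (M₀ : Matrix X X E) {n : ℕ} (M : Fin n → Matrix X X E) {j : ℕ} (hj : j < n) :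
    chainLinks M₀ M (j + 1) = fun u v => M ⟨j, hj⟩ u v := by
  funext u v
  simp [chainLinks, hj]

/-- beyond the chain the links are zero (never reached by `pathKernel … n`). [cite: Dimock2004QED3TorusII, §3.2 Thm 1 proof Part III (152) p.24 L59–75] -/
theorem chainLinks_succ_of_le (M₀ : Matrix X X E) {n : ℕ} (M : Fin n → Matrix X X E) {j : ℕ} (hj : n ≤ j) :
    chainLinks M₀ M (j + 1) = fun _ _ => 0 := by
  funext u v
  simp [chainLinks, Nat.not_lt.2 hj]

/-- dropping the first link shifts the family. [cite: Dimock2004QED3TorusII, §3.2 Thm 1 proof Part III (152) p.24 L59–75] -/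
theorem chainLinks_shift (M₀ : Matrix X X E) {n : ℕ} (M : Fin (n + 1) → Matrix X X E) :
    (fun j => chainLinks M₀ M (j + 1)) = chainLinks (M 0) (fun i : Fin n => M i.succ) := by
  funext j
  rcases Nat.eq_zero_or_pos j with rfl | hj
  · rw [chainLinks_succ_of_lt M₀ M (Nat.succ_pos n), chainLinks_zero]
    rfl
  · obtain ⟨i, rfl⟩ := Nat.exists_eq_add_one_of_ne_zero hj.ne'
    by_cases hi : i < n
    · rw [chainLinks_succ_of_lt M₀ M (Nat.succ_lt_succ hi), chainLinks_succ_of_lt (M 0) _ hi]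
      rfl
    · rw [chainLinks_succ_of_le M₀ M (by omega), chainLinks_succ_of_le (M 0) _ (not_lt.1 hi)]

variable [Fintype X] [DecidableEq X] [NormedAlgebra ℝ E]

/-- **(152): the entries of an operator chain are the iterated «integrals»** `(M₀M_1⋯M_n)(x,y) =
Σ_{x_1…x_n}M₀(x,x_1)M_1(x_1,x_2)⋯M_n(x_n,y)` = `pathKernel 1 (chainLinks M₀ M) n x y` (the lattice weight of `∫` is inside the
entries). [cite: Dimock2004QED3TorusII, §3.2 Thm 1 proof Part III (152) p.24 L59–75] -/
theorem mul_listProd_apply (M₀ : Matrix X X E) :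
    ∀ {n : ℕ} (M : Fin n → Matrix X X E) (x y : X),
      (M₀ * (List.ofFn M).prod) x y = pathKernel 1 (chainLinks M₀ M) n x y
  | 0, M, x, y => by
      rw [List.ofFn_zero, List.prod_nil, mul_one]
      rfl
  | n + 1, M, x, y => by
      rw [List.ofFn_succ, List.prod_cons, Matrix.mul_apply]
      show ∑ x₁, M₀ x x₁ * (M 0 * (List.ofFn fun i : Fin n => M i.succ).prod) x₁ y
        = ∑ x₁, (1 : ℝ) • (chainLinks M₀ M 0 x x₁ * pathKernel 1 (fun j => chainLinks M₀ M (j + 1)) n x₁ y)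
      rw [chainLinks_shift, chainLinks_zero]
      refine sum_congr rfl fun x₁ _ => ?_
      rw [one_smul, mul_listProd_apply (M 0) (fun i : Fin n => M i.succ) x₁ y]

end Entries

/-! ## §3 The walk terms and their entries: vanishing and the bound (134) -/

section WalkTerms

variable {X : Type*} [Fintype X] [DecidableEq X] {E : Type*} [NormedRing E]
variable {Z : Type*}

/-- **the path operator `S_{k,Λ,ω}(A)`** of `ω = (□_0,…,□_n)`: `(h_{□_0}S*_{□_0}h_{□_0})(R_{□_1}S*_{□_1}h_{□_1})⋯(R_{□_n}S*_{□_n}h_{□_n})`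
(= the tree's `walkTerm (ω 0) (tail ω)`, `walkTerm_eq_chainProd`). [cite: Dimock2004QED3TorusII, §3.2 Thm 1 proof Part I (142) p.23 L31–40] -/
def chainProd (A : Matrix X X E) (H G : Z → Matrix X X E) {n : ℕ} (ω : Fin (n + 1) → Z) : Matrix X X E :=
  link0 H G (ω 0) * (List.ofFn fun j : Fin n => linkR A H G (ω j.succ)).prod

/-- `walkTerm z₀ ω = chainProd (z₀ :: ω)`. [cite: Dimock2004QED3TorusII, §3.2 Thm 1 proof Part I (142) p.23 L31–40] -/
theorem walkTerm_eq_chainProd (A : Matrix X X E) (H G : Z → Matrix X X E) (z₀ : Z) {n : ℕ} (ω : Fin n → Z) :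
    walkTerm A H G z₀ ω = chainProd A H G (Fin.cons z₀ ω : Fin (n + 1) → Z) := by
  rw [walkTerm_eq, chainProd]
  simp only [Fin.cons_zero, Fin.cons_succ]

/-- **non-paths contribute nothing**: if some consecutive pair of `ω` is not adjacent, `S_ω = 0`.
[cite: Dimock2004QED3TorusII, §3.2 Thm 1 proof Part I p.23 L29–31] -/
theorem chainProd_eq_zero_of_not_adj (A : Matrix X X E) (H G : Z → Matrix X X E) (adj : Z → Z → Prop)
    (hadj : ∀ z z', ¬ adj z z' → H z * Kz A H z' = 0) {n : ℕ} (ω : Fin (n + 1) → Z)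
    (hω : ¬ ∀ j : Fin n, adj (ω j.castSucc) (ω j.succ)) : chainProd A H G ω = 0 := by
  cases n with
  | zero => exact absurd (fun j => Fin.elim0 j) hω
  | succ m =>
      unfold chainProd
      by_cases h0 : adj (ω (0 : Fin (m + 1)).castSucc) (ω (0 : Fin (m + 1)).succ)
      · have htail : ¬ ∀ j : Fin m, adj ((fun i : Fin (m + 1) => ω i.succ) j.castSucc)
            ((fun i : Fin (m + 1) => ω i.succ) j.succ) := by
          intro hall
          apply hω
          intro j
          refine Fin.cases ?_ (fun j' => ?_) j
          · exact h0
          · show adj (ω j'.succ.castSucc) (ω j'.succ.succ)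
            rw [← Fin.succ_castSucc]
            exact hall j'
        rw [tailProd_eq_zero A H G adj hadj m (fun i : Fin (m + 1) => ω i.succ) htail, mul_zero]
      · have hz : link0 H G (ω 0) * linkR A H G ((fun i : Fin (m + 1) => ω i.succ) 0) = 0 :=
          link0_mul_linkR_eq_zero (hadj _ _ (by rwa [Fin.castSucc_zero] at h0))
        rw [List.ofFn_succ, List.prod_cons, ← mul_assoc, hz, zero_mul]

/-- **`S_{k,Λ,ω}(A,x,y)` vanishes unless `x ∈ supp h_{□_0}`**: a zero `x`-row of the first link gives a zero `x`-row of
the path operator. [cite: Dimock2004QED3TorusII, §3.2 Thm 1 proof Part I p.23 L31–32] -/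
theorem chainProd_apply_eq_zero_of_row (A : Matrix X X E) (H G : Z → Matrix X X E) {n : ℕ}
    (ω : Fin (n + 1) → Z) (x y : X) (hrow : ∀ v, link0 H G (ω 0) x v = 0) : chainProd A H G ω x y = 0 := by
  unfold chainProd
  rw [Matrix.mul_apply]
  exact sum_eq_zero fun v _ => by rw [hrow v, zero_mul]

variable [NormedAlgebra ℝ E]
variable {B : Type*} [Fintype B] [DecidableEq B]
variable {d P₀ Q : X → X → ℝ} {blk : X → B} {ctr : B → X} {c r θ : ℝ}

/-- **(134) ∕ (195) for every path** (two-profile member): from the first-link bound `‖(h_□S*_□h_□)(u,v)‖ ≤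
C₀P₀(u,v)e^{−cd(u,v)}` ((137), resp. (198)), the later-link bound `‖(R_□S*_□h_□)(u,v)‖ ≤ (C₁∕M₀)Q(u,v)e^{−cd(u,v)}` ((143),
resp. (201); `Q` may carry the position-dependent scale factors) and the geometry of the tree's `dimock195` (`w = 1`:
block convolution bounds `Σ_ΔQQ ≤ θQ`, `Σ_ΔP₀Q ≤ θP₀`, centres within `r`, one-point sum `K`):
`‖S_ω(x,y)‖ ≤ C₀e^{3cr}(C₁θKe^{2cr}∕M₀)^{|ω|}P₀(x,y)e^{−(c∕2)d(x,y)}` — `dimock195` BY NAME.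
[cite: Dimock2004QED3TorusII, §3.2 Thm 1 (134) p.22 L17–19, proof Part III (152)–(155) p.24 L59 – p.25 L10; Thm 2 (195) p.30 L1–5] -/
theorem norm_chainProd_apply_le (hθ : 0 ≤ θ) (hc : 0 ≤ c) (hQ0 : ∀ u v, 0 ≤ Q u v) (hP₀0 : ∀ u v, 0 ≤ P₀ u v)
    (hconv : ∀ (b : B) (u v : X),
      ∑ y ∈ univ.filter (fun u => blk u = b), (1 : ℝ) * (Q u y * Q y v) ≤ θ * Q u v)
    (hconv₀ : ∀ (b : B) (u v : X),
      ∑ y ∈ univ.filter (fun u => blk u = b), (1 : ℝ) * (P₀ u y * Q y v) ≤ θ * P₀ u v)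
    (hd0 : ∀ u v, 0 ≤ d u v) (hsymm : ∀ u v, d u v = d v u) (htri : ∀ u v t, d u t ≤ d u v + d v t)
    (hrad : ∀ u, d u (ctr (blk u)) ≤ r) {K : ℝ}
    (hK : ∀ b : B, ∑ b', Real.exp (-(c / 2) * d (ctr b) (ctr b')) ≤ K)
    (A : Matrix X X E) (H G : Z → Matrix X X E) {C₀ C₁ M₀ : ℝ} (hC₀ : 0 ≤ C₀) (hC₁ : 0 ≤ C₁)
    (hM₀ : 0 < M₀)
    (h0 : ∀ z u v, ‖link0 H G z u v‖ ≤ C₀ * (P₀ u v * Real.exp (-(c * d u v))))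
    (hR : ∀ z u v, ‖linkR A H G z u v‖ ≤ C₁ / M₀ * (Q u v * Real.exp (-(c * d u v))))
    {n : ℕ} (ω : Fin (n + 1) → Z) (x y : X) :
    ‖chainProd A H G ω x y‖ ≤ C₀ * Real.exp (3 * c * r) * (C₁ * θ * K * Real.exp (2 * c * r) / M₀) ^ n
        * P₀ x y * Real.exp (-(c / 2) * d x y) := by
  unfold chainProd
  rw [mul_listProd_apply]
  refine dimock195 (w := 1) zero_le_one hθ hc hQ0 hP₀0 hconv hconv₀ hd0 hsymm htri hrad hK hC₀ hC₁ hM₀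
    _ ?_ ?_ n x y
  · intro u v
    rw [chainLinks_zero]
    exact h0 _ u v
  · intro j u v
    by_cases hj : j < n
    · rw [chainLinks_succ_of_lt _ _ hj]
      exact hR _ u v
    · rw [chainLinks_succ_of_le _ _ (not_lt.1 hj), norm_zero]
      exact mul_nonneg (div_nonneg hC₁ hM₀.le) (mul_nonneg (hQ0 u v) (Real.exp_pos _).le)

/-- **the same estimate for the terms of `R^{m+1}`** (chains of `m+1` `R`-links, profile `Q` throughout; first-link
constant `C₁∕M₀`). [cite: Dimock2004QED3TorusII, §3.2 Thm 1 proof Part III (152)–(155) p.24 L59 – p.25 L12] -/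
theorem norm_tailProd_apply_le (hθ : 0 ≤ θ) (hc : 0 ≤ c) (hQ0 : ∀ u v, 0 ≤ Q u v)
    (hconv : ∀ (b : B) (u v : X),
      ∑ y ∈ univ.filter (fun u => blk u = b), (1 : ℝ) * (Q u y * Q y v) ≤ θ * Q u v)
    (hd0 : ∀ u v, 0 ≤ d u v) (hsymm : ∀ u v, d u v = d v u) (htri : ∀ u v t, d u t ≤ d u v + d v t)
    (hrad : ∀ u, d u (ctr (blk u)) ≤ r) {K : ℝ}
    (hK : ∀ b : B, ∑ b', Real.exp (-(c / 2) * d (ctr b) (ctr b')) ≤ K)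
    (A : Matrix X X E) (H G : Z → Matrix X X E) {C₁ M₀ : ℝ} (hC₁ : 0 ≤ C₁) (hM₀ : 0 < M₀)
    (hR : ∀ z u v, ‖linkR A H G z u v‖ ≤ C₁ / M₀ * (Q u v * Real.exp (-(c * d u v))))
    {m : ℕ} (ω : Fin (m + 1) → Z) (x y : X) :
    ‖(List.ofFn fun j => linkR A H G (ω j)).prod x y‖
      ≤ C₁ / M₀ * Real.exp (3 * c * r) * (C₁ * θ * K * Real.exp (2 * c * r) / M₀) ^ m
        * Q x y * Real.exp (-(c / 2) * d x y) := by
  rw [List.ofFn_succ, List.prod_cons, mul_listProd_apply]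
  refine dimock195 (w := 1) zero_le_one hθ hc hQ0 hQ0 hconv hconv hd0 hsymm htri hrad hK
    (div_nonneg hC₁ hM₀.le) hC₁ hM₀ _ ?_ ?_ m x y
  · intro u v
    rw [chainLinks_zero]
    exact hR _ u v
  · intro j u v
    by_cases hj : j < m
    · rw [chainLinks_succ_of_lt _ _ hj]
      exact hR _ u v
    · rw [chainLinks_succ_of_le _ _ (not_lt.1 hj), norm_zero]
      exact mul_nonneg (div_nonneg hC₁ hM₀.le) (mul_nonneg (hQ0 u v) (Real.exp_pos _).le)

end WalkTerms

/-! ## §4 THEOREM 1 assembled: the expansion converges entrywise and IS the inverse, with (135) -/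

section Generic

variable {X : Type*} [Fintype X] [DecidableEq X] {E : Type*} [NormedRing E]

open _root_.Topology in
/-- **«`S*(A)Σ_nR^n` inverts … provided the series converges», made precise**: for square matrices with `A·G_s = 1 − K`, if
every entry series `Σ_n(G_sK^n)(x,y)` is summable and `K^N → 0` entry by entry, then `A·(Σ'_nG_sK^n) = 1` (the partial sums
give `1 − K^N`; pass to the limit). [cite: Dimock2004QED3TorusII, §3.2 Thm 1 proof Part I (141) p.23 L26–31] -/
theorem mul_tsum_eq_one_of_entrywise {A Gs K : Matrix X X E} (h : A * Gs = 1 - K)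
    (hsum : ∀ x y, Summable fun n => (Gs * K ^ n) x y)
    (hKN : ∀ x y, Tendsto (fun N => (K ^ N) x y) atTop (𝓝 0)) :
    A * Matrix.of (fun x y => ∑' n, (Gs * K ^ n) x y) = 1 := by
  set S : Matrix X X E := Matrix.of fun x y => ∑' n, (Gs * K ^ n) x y with hS
  have hT : HasSum (fun n => Gs * K ^ n) S :=
    Pi.hasSum.2 fun x => Pi.hasSum.2 fun y => (hsum x y).hasSum
  have hlim1 : Tendsto (fun N => (1 : Matrix X X E) - K ^ N) atTop (𝓝 (A * S)) := by
    refine ((hT.mul_left A).tendsto_sum_nat).congr fun N => ?_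
    rw [← mul_sum, ← mul_sum, ← mul_assoc, h, mul_neg_geom_sum]
  have hKN' : Tendsto (fun N => K ^ N) atTop (𝓝 (0 : Matrix X X E)) :=
    tendsto_pi_nhds.2 fun x => tendsto_pi_nhds.2 fun y => hKN x y
  have hlim2 : Tendsto (fun N => (1 : Matrix X X E) - K ^ N) atTop (𝓝 (1 - 0)) :=
    tendsto_const_nhds.sub hKN'
  rw [sub_zero] at hlim2
  exact tendsto_nhds_unique hlim1 hlim2

open _root_.Topology in
/-- … and for commutative coefficients the sum is a two-sided inverse, `= A^{−1}` (`S_{k,Λ}(A) = S*(A)(I − R)^{−1}`).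
[cite: Dimock2004QED3TorusII, §3.2 Thm 1 proof Part I (141) p.23 L26–31 and §3.1 (119) p.20 L4–9] -/
theorem inv_eq_tsum_of_entrywise {E : Type*} [NormedCommRing E] {A Gs K : Matrix X X E} (h : A * Gs = 1 - K)
    (hsum : ∀ x y, Summable fun n => (Gs * K ^ n) x y)
    (hKN : ∀ x y, Tendsto (fun N => (K ^ N) x y) atTop (𝓝 0)) :
    Matrix.of (fun x y => ∑' n, (Gs * K ^ n) x y) * A = 1 ∧
      A⁻¹ = Matrix.of (fun x y => ∑' n, (Gs * K ^ n) x y) :=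
  ⟨mul_eq_one_comm.1 (mul_tsum_eq_one_of_entrywise h hsum hKN),
    Matrix.inv_eq_right_inv (mul_tsum_eq_one_of_entrywise h hsum hKN)⟩

end Generic

section Assembly

variable {X : Type*} [Fintype X] [DecidableEq X] {E : Type*} [NormedRing E] [NormedAlgebra ℝ E]
variable {Z : Type*} [Fintype Z] [DecidableEq Z]

omit [DecidableEq Z] in
/-- reindexing `(□_0, (□_1,…,□_n)) ↔ (□_0,…,□_n)`. [cite: Dimock2004QED3TorusII, §3.2 (132) p.22 L7–11] -/
private theorem sum_sum_eq_sum_succ {M : Type*} [AddCommMonoid M] {n : ℕ} (f : Z → (Fin n → Z) → M) :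
    ∑ z₀, ∑ ω : Fin n → Z, f z₀ ω = ∑ ω' : Fin (n + 1) → Z, f (ω' 0) (Fin.tail ω') := by
  rw [← Fintype.sum_prod_type']
  refine Fintype.sum_equiv (Fin.consEquiv fun _ => Z) _ _ fun p => ?_
  simp [Fin.consEquiv, Fin.tail_cons]

omit [NormedAlgebra ℝ E] [DecidableEq Z] in
/-- **(142), the `n`-link part entrywise**: `(S*(A)R^n)(x,y) = Σ_{(□_0,…,□_n)}S_ω(x,y)` over ALL sequences of cubes (the
non-paths contribute zero, `chainProd_eq_zero_of_not_adj`). [cite: Dimock2004QED3TorusII, §3.2 Thm 1 proof Part I (142) p.23 L31–40] -/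
theorem gstar_mul_kop_pow_apply (A : Matrix X X E) (H G : Z → Matrix X X E) (n : ℕ) (x y : X) :
    (Gstar H G * Kop A H G ^ n) x y = ∑ ω : Fin (n + 1) → Z, chainProd A H G ω x y := by
  rw [Gstar_mul_Kop_pow, Matrix.sum_apply]
  simp_rw [Matrix.sum_apply]
  rw [sum_sum_eq_sum_succ (fun z₀ ω => walkTerm A H G z₀ ω x y)]
  refine sum_congr rfl fun ω _ => ?_
  rw [walkTerm_eq_chainProd, Fin.cons_self_tail]

omit [NormedAlgebra ℝ E] [DecidableEq Z] in
/-- the tails entrywise: `R^{m+1}(x,y) = Σ_{(□_0,…,□_m)}(R_{□_0}S*_{□_0}h_{□_0}⋯R_{□_m}S*_{□_m}h_{□_m})(x,y)`.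
[cite: Dimock2004QED3TorusII, §3.2 Thm 1 proof Part I (141)–(142) p.23 L26–40] -/
theorem kop_pow_succ_apply (A : Matrix X X E) (H G : Z → Matrix X X E) (m : ℕ) (x y : X) :
    (Kop A H G ^ (m + 1)) x y = ∑ ω : Fin (m + 1) → Z, (List.ofFn fun j => linkR A H G (ω j)).prod x y := by
  rw [Kop_pow, Matrix.sum_apply]
  rfl

variable {B : Type*} [Fintype B] [DecidableEq B]
variable {d P₀ Q : X → X → ℝ} {blk : X → B} {ctr : B → X} {c r θ : ℝ}
variable (adj : Z → Z → Prop) [DecidableRel adj]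

/-- **«we sum over paths»**: with `≤ ν` start cubes at `x` and `≤ ν` cubes adjacent to any cube (`ν = 27`), the `n`-link
part obeys `‖(S*(A)R^n)(x,y)‖ ≤ ν^{n+1}·C₀e^{3cr}(C₁θKe^{2cr}∕M₀)^n·P₀(x,y)e^{−(c∕2)d(x,y)}` — (134) times the path count
(`card_walks_le` BY NAME). [cite: Dimock2004QED3TorusII, §3.2 Thm 1 proof Part III p.25 L10–12] -/
theorem norm_gstar_mul_kop_pow_apply_le (hθ : 0 ≤ θ) (hc : 0 ≤ c) (hQ0 : ∀ u v, 0 ≤ Q u v)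
    (hP₀0 : ∀ u v, 0 ≤ P₀ u v)
    (hconv : ∀ (b : B) (u v : X),
      ∑ y ∈ univ.filter (fun u => blk u = b), (1 : ℝ) * (Q u y * Q y v) ≤ θ * Q u v)
    (hconv₀ : ∀ (b : B) (u v : X),
      ∑ y ∈ univ.filter (fun u => blk u = b), (1 : ℝ) * (P₀ u y * Q y v) ≤ θ * P₀ u v)
    (hd0 : ∀ u v, 0 ≤ d u v) (hsymm : ∀ u v, d u v = d v u) (htri : ∀ u v t, d u t ≤ d u v + d v t)
    (hrad : ∀ u, d u (ctr (blk u)) ≤ r) {K : ℝ}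
    (hK : ∀ b : B, ∑ b', Real.exp (-(c / 2) * d (ctr b) (ctr b')) ≤ K)
    (A : Matrix X X E) (H G : Z → Matrix X X E) {C₀ C₁ M₀ : ℝ} (hC₀ : 0 ≤ C₀) (hC₁ : 0 ≤ C₁)
    (hM₀ : 0 < M₀)
    (h0 : ∀ z u v, ‖link0 H G z u v‖ ≤ C₀ * (P₀ u v * Real.exp (-(c * d u v))))
    (hR : ∀ z u v, ‖linkR A H G z u v‖ ≤ C₁ / M₀ * (Q u v * Real.exp (-(c * d u v))))
    (hadj : ∀ z z', ¬ adj z z' → H z * Kz A H z' = 0) {ν : ℕ}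
    (hadjcard : ∀ z, (univ.filter fun z' => adj z z').card ≤ ν)
    (S₀ : X → Finset Z) (hS₀ : ∀ x, ∀ z ∉ S₀ x, ∀ v, link0 H G z x v = 0)
    (hS₀card : ∀ x, (S₀ x).card ≤ ν) (n : ℕ) (x y : X) :
    ‖(Gstar H G * Kop A H G ^ n) x y‖
      ≤ (ν : ℝ) ^ (n + 1) * (C₀ * Real.exp (3 * c * r) * (C₁ * θ * K * Real.exp (2 * c * r) / M₀) ^ n
          * P₀ x y * Real.exp (-(c / 2) * d x y)) := by
  rw [gstar_mul_kop_pow_apply]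
  have hvanish : ∀ ω ∈ (univ : Finset (Fin (n + 1) → Z)), ω ∉ walks adj (S₀ x) n →
      chainProd A H G ω x y = 0 := by
    intro ω _ hω
    rw [mem_walks, not_and_or] at hω
    rcases hω with h1 | h2
    · exact chainProd_apply_eq_zero_of_row A H G ω x y (hS₀ x _ h1)
    · rw [chainProd_eq_zero_of_not_adj A H G adj hadj ω h2]
      rfl
  rw [← sum_subset (subset_univ (walks adj (S₀ x) n)) hvanish]
  have hK0 : 0 ≤ K := (sum_nonneg fun b' _ => (Real.exp_pos _).le).trans (hK (blk x))
  set Φ := C₀ * Real.exp (3 * c * r) * (C₁ * θ * K * Real.exp (2 * c * r) / M₀) ^ n * P₀ x y *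
    Real.exp (-(c / 2) * d x y) with hΦ
  have hq0 : 0 ≤ C₁ * θ * K * Real.exp (2 * c * r) / M₀ := by positivity
  have hΦ0 : 0 ≤ Φ :=
    mul_nonneg (mul_nonneg (mul_nonneg (mul_nonneg hC₀ (Real.exp_pos _).le) (pow_nonneg hq0 n)) (hP₀0 x y))
      (Real.exp_pos _).le
  calc ‖∑ ω ∈ walks adj (S₀ x) n, chainProd A H G ω x y‖
      ≤ ∑ ω ∈ walks adj (S₀ x) n, ‖chainProd A H G ω x y‖ := norm_sum_le _ _
    _ ≤ ∑ _ω ∈ walks adj (S₀ x) n, Φ := sum_le_sum fun ω _ =>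
        norm_chainProd_apply_le hθ hc hQ0 hP₀0 hconv hconv₀ hd0 hsymm htri hrad hK A H G hC₀ hC₁ hM₀ h0 hR
          ω x y
    _ = ((walks adj (S₀ x) n).card : ℝ) * Φ := by rw [sum_const, nsmul_eq_mul]
    _ ≤ (ν : ℝ) ^ (n + 1) * Φ :=
        mul_le_mul_of_nonneg_right (by exact_mod_cast card_walks_le (hS₀card x) hadjcard n) hΦ0

/-- **the tails**: `‖R^{m+1}(x,y)‖ ≤ ν^{m+1}·(C₁∕M₀)e^{3cr}(C₁θKe^{2cr}∕M₀)^m·Q(x,y)e^{−(c∕2)d(x,y)}` (start cubes of the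
`R`-links at `x`: `≤ ν`). [cite: Dimock2004QED3TorusII, §3.2 Thm 1 proof Part III p.25 L10–12 with Part I (141) p.23 L26–31] -/
theorem norm_kop_pow_succ_apply_le (hθ : 0 ≤ θ) (hc : 0 ≤ c) (hQ0 : ∀ u v, 0 ≤ Q u v)
    (hconv : ∀ (b : B) (u v : X),
      ∑ y ∈ univ.filter (fun u => blk u = b), (1 : ℝ) * (Q u y * Q y v) ≤ θ * Q u v)
    (hd0 : ∀ u v, 0 ≤ d u v) (hsymm : ∀ u v, d u v = d v u) (htri : ∀ u v t, d u t ≤ d u v + d v t)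
    (hrad : ∀ u, d u (ctr (blk u)) ≤ r) {K : ℝ}
    (hK : ∀ b : B, ∑ b', Real.exp (-(c / 2) * d (ctr b) (ctr b')) ≤ K)
    (A : Matrix X X E) (H G : Z → Matrix X X E) {C₁ M₀ : ℝ} (hC₁ : 0 ≤ C₁) (hM₀ : 0 < M₀)
    (hR : ∀ z u v, ‖linkR A H G z u v‖ ≤ C₁ / M₀ * (Q u v * Real.exp (-(c * d u v))))
    (hadj : ∀ z z', ¬ adj z z' → H z * Kz A H z' = 0) {ν : ℕ}
    (hadjcard : ∀ z, (univ.filter fun z' => adj z z').card ≤ ν)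
    (S₁ : X → Finset Z) (hS₁ : ∀ x, ∀ z ∉ S₁ x, ∀ v, linkR A H G z x v = 0)
    (hS₁card : ∀ x, (S₁ x).card ≤ ν) (m : ℕ) (x y : X) :
    ‖(Kop A H G ^ (m + 1)) x y‖
      ≤ (ν : ℝ) ^ (m + 1) * (C₁ / M₀ * Real.exp (3 * c * r) * (C₁ * θ * K * Real.exp (2 * c * r) / M₀) ^ m
          * Q x y * Real.exp (-(c / 2) * d x y)) := by
  rw [kop_pow_succ_apply]
  have hvanish : ∀ ω ∈ (univ : Finset (Fin (m + 1) → Z)), ω ∉ walks adj (S₁ x) m →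
      (List.ofFn fun j => linkR A H G (ω j)).prod x y = 0 := by
    intro ω _ hω
    rw [mem_walks, not_and_or] at hω
    rcases hω with h1 | h2
    · rw [List.ofFn_succ, List.prod_cons, Matrix.mul_apply]
      exact sum_eq_zero fun v _ => by rw [hS₁ x _ h1 v, zero_mul]
    · rw [tailProd_eq_zero A H G adj hadj m ω h2]
      rfl
  rw [← sum_subset (subset_univ (walks adj (S₁ x) m)) hvanish]
  have hK0 : 0 ≤ K := (sum_nonneg fun b' _ => (Real.exp_pos _).le).trans (hK (blk x))
  set Φ := C₁ / M₀ * Real.exp (3 * c * r) * (C₁ * θ * K * Real.exp (2 * c * r) / M₀) ^ m * Q x y *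
    Real.exp (-(c / 2) * d x y) with hΦ
  have hq0 : 0 ≤ C₁ * θ * K * Real.exp (2 * c * r) / M₀ := by positivity
  have hΦ0 : 0 ≤ Φ :=
    mul_nonneg (mul_nonneg (mul_nonneg (mul_nonneg (div_nonneg hC₁ hM₀.le) (Real.exp_pos _).le)
      (pow_nonneg hq0 m)) (hQ0 x y)) (Real.exp_pos _).le
  calc ‖∑ ω ∈ walks adj (S₁ x) m, (List.ofFn fun j => linkR A H G (ω j)).prod x y‖
      ≤ ∑ ω ∈ walks adj (S₁ x) m, ‖(List.ofFn fun j => linkR A H G (ω j)).prod x y‖ := norm_sum_le _ _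
    _ ≤ ∑ _ω ∈ walks adj (S₁ x) m, Φ := sum_le_sum fun ω _ =>
        norm_tailProd_apply_le hθ hc hQ0 hconv hd0 hsymm htri hrad hK A H G hC₁ hM₀ hR ω x y
    _ = ((walks adj (S₁ x) m).card : ℝ) * Φ := by rw [sum_const, nsmul_eq_mul]
    _ ≤ (ν : ℝ) ^ (m + 1) * Φ :=
        mul_le_mul_of_nonneg_right (by exact_mod_cast card_walks_le (hS₁card x) hadjcard m) hΦ0

/-- **the random walk expansion, summed entry by entry**: `S_{k,Λ}(A)(x,y) := Σ'_n(S*(A)R^n)(x,y)` (= `Σ_ωS_{k,Λ,ω}(A,x,y)`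
grouped by the number of links). [cite: Dimock2004QED3TorusII, §3.2 (132) p.22 L2–6 and Thm 1 proof Part I (141)–(142) p.23 L26–40] -/
def walkExpansion (A : Matrix X X E) (H G : Z → Matrix X X E) : Matrix X X E :=
  Matrix.of fun x y => ∑' n, (Gstar H G * Kop A H G ^ n) x y

/-- **THEOREM 1, assembled** (and THEOREM 2 by the same token).  Hypotheses: (125) `Σ_□h_□² = 1`; (136) `h_□AS*_□ = h_□`;
the first-link bound with profile `P₀` ((137): `d′^{−2}`; (198): `d′^{−1}`) and the later-link bound with profile `Q`
((143): `L^{k−i}d′^{−2}`; (201): `L^{2(k−i)}d′^{−1} + L^{k−i}d′^{−2}`) — LEMMA 2 ∕ 3 and Part II in printed shape; the block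
convolution bounds for `(Q,Q)` and `(P₀,Q)` ((154), resp. (202) ∕ (203)); the support facts (`h_□R_{□′} = 0` for
non-adjacent cubes, `≤ ν` neighbours, `≤ ν` start cubes at every site for both kinds of links); the geometry of the tree's
`dimock195`; and *"`M₀` sufficiently large"* = `2νC₁θKe^{2cr} ≤ M₀`.  Conclusions: (i) every entry series
`Σ_n(S*(A)R^n)(x,y)` converges (absolutely) — *"provided the series converges"* discharged; (ii) `A·S_{k,Λ}(A) = 1` —
*"Then `S_{k,Λ}(A,x,y)` exists"*; (iii) **(135)** `‖S_{k,Λ}(A;x,y)‖ ≤ 2νC₀e^{3cr}·P₀(x,y)e^{−(c∕2)d(x,y)}` — the printed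
`O(1)d′(x,y)^{−2}exp(−O(1)d_Λ(x,y))` with its `O(1)`s explicit.
[cite: Dimock2004QED3TorusII, §3.2 Thm 1 (132)–(135) p.22 L2–21, proof Parts I and III p.23 L1–40, p.24 L59 – p.25 L12; Thm 2 (195) p.30 L1–5] -/
theorem dimock_thm1 [CompleteSpace E] (hθ : 0 ≤ θ) (hc : 0 ≤ c) (hQ0 : ∀ u v, 0 ≤ Q u v)
    (hP₀0 : ∀ u v, 0 ≤ P₀ u v)
    (hconv : ∀ (b : B) (u v : X),
      ∑ y ∈ univ.filter (fun u => blk u = b), (1 : ℝ) * (Q u y * Q y v) ≤ θ * Q u v)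
    (hconv₀ : ∀ (b : B) (u v : X),
      ∑ y ∈ univ.filter (fun u => blk u = b), (1 : ℝ) * (P₀ u y * Q y v) ≤ θ * P₀ u v)
    (hd0 : ∀ u v, 0 ≤ d u v) (hsymm : ∀ u v, d u v = d v u) (htri : ∀ u v t, d u t ≤ d u v + d v t)
    (hrad : ∀ u, d u (ctr (blk u)) ≤ r) {K : ℝ}
    (hK : ∀ b : B, ∑ b', Real.exp (-(c / 2) * d (ctr b) (ctr b')) ≤ K)
    (A : Matrix X X E) (H G : Z → Matrix X X E)
    (h125 : ∑ z, H z * H z = 1) (h136 : ∀ z, H z * A * G z = H z)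
    {C₀ C₁ M₀ : ℝ} (hC₀ : 0 ≤ C₀) (hC₁ : 0 ≤ C₁) (hM₀ : 0 < M₀)
    (h0 : ∀ z u v, ‖link0 H G z u v‖ ≤ C₀ * (P₀ u v * Real.exp (-(c * d u v))))
    (hR : ∀ z u v, ‖linkR A H G z u v‖ ≤ C₁ / M₀ * (Q u v * Real.exp (-(c * d u v))))
    (hadj : ∀ z z', ¬ adj z z' → H z * Kz A H z' = 0) {ν : ℕ}
    (hadjcard : ∀ z, (univ.filter fun z' => adj z z').card ≤ ν)
    (S₀ : X → Finset Z) (hS₀ : ∀ x, ∀ z ∉ S₀ x, ∀ v, link0 H G z x v = 0)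
    (hS₀card : ∀ x, (S₀ x).card ≤ ν)
    (S₁ : X → Finset Z) (hS₁ : ∀ x, ∀ z ∉ S₁ x, ∀ v, linkR A H G z x v = 0)
    (hS₁card : ∀ x, (S₁ x).card ≤ ν)
    (hlarge : 2 * ((ν : ℝ) * (C₁ * θ * K * Real.exp (2 * c * r))) ≤ M₀) :
    (∀ x y, Summable fun n => (Gstar H G * Kop A H G ^ n) x y) ∧
    A * walkExpansion A H G = 1 ∧
    ∀ x y, ‖walkExpansion A H G x y‖
      ≤ 2 * ν * (C₀ * Real.exp (3 * c * r)) * (P₀ x y * Real.exp (-(c / 2) * d x y)) := by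
  have hK0 : ∀ x : X, 0 ≤ K := fun x => (sum_nonneg fun b' _ => (Real.exp_pos _).le).trans (hK (blk x))
  set q : ℝ := C₁ * θ * K * Real.exp (2 * c * r) / M₀ with hq
  have hν : (0 : ℝ) ≤ ν := Nat.cast_nonneg ν
  have hνq : ∀ x : X, 0 ≤ (ν : ℝ) * q ∧ (ν : ℝ) * q ≤ 1 / 2 := by
    intro x
    have hK0' := hK0 x
    refine ⟨by positivity, ?_⟩
    rw [hq, ← mul_div_assoc, div_le_iff₀ hM₀]
    linarith
  -- (a) the n-link bound
  have hterm : ∀ n x y, ‖(Gstar H G * Kop A H G ^ n) x y‖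
      ≤ (ν : ℝ) * (C₀ * Real.exp (3 * c * r)) * (P₀ x y * Real.exp (-(c / 2) * d x y)) * ((ν : ℝ) * q) ^ n := by
    intro n x y
    have h := norm_gstar_mul_kop_pow_apply_le adj hθ hc hQ0 hP₀0 hconv hconv₀ hd0 hsymm htri hrad hK A H G
      hC₀ hC₁ hM₀ h0 hR hadj hadjcard S₀ hS₀ hS₀card n x y
    refine h.trans (le_of_eq ?_)
    rw [pow_succ, mul_pow]
    ring
  have hsumNorm : ∀ x y, Summable fun n => ‖(Gstar H G * Kop A H G ^ n) x y‖ := by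
    intro x y
    obtain ⟨h0q, hq2⟩ := hνq x
    exact Summable.of_nonneg_of_le (fun n => norm_nonneg _) (fun n => hterm n x y)
      ((summable_geometric_of_lt_one h0q (hq2.trans_lt (by norm_num))).mul_left _)
  have hsum : ∀ x y, Summable fun n => (Gstar H G * Kop A H G ^ n) x y := fun x y => (hsumNorm x y).of_norm
  -- (c) the tails tend to zero
  have hKN : ∀ x y, Tendsto (fun N => (Kop A H G ^ N) x y) atTop (nhds 0) := by
    intro x y
    obtain ⟨h0q, hq2⟩ := hνq x
    rw [← tendsto_add_atTop_iff_nat 1]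
    have hb : ∀ m, ‖(Kop A H G ^ (m + 1)) x y‖
        ≤ (ν : ℝ) * (C₁ / M₀ * Real.exp (3 * c * r)) * (Q x y * Real.exp (-(c / 2) * d x y))
            * ((ν : ℝ) * q) ^ m := by
      intro m
      have h := norm_kop_pow_succ_apply_le adj hθ hc hQ0 hconv hd0 hsymm htri hrad hK A H G hC₁ hM₀ hR hadj
        hadjcard S₁ hS₁ hS₁card m x y
      refine h.trans (le_of_eq ?_)
      rw [pow_succ, mul_pow]
      ring
    refine squeeze_zero_norm hb ?_
    rw [← mul_zero ((ν : ℝ) * (C₁ / M₀ * Real.exp (3 * c * r)) * (Q x y * Real.exp (-(c / 2) * d x y)))]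
    exact (tendsto_pow_atTop_nhds_zero_of_lt_one h0q (hq2.trans_lt (by norm_num))).const_mul _
  have hAG : A * Gstar H G = 1 - Kop A H G := op_mul_Gstar h125 h136
  refine ⟨hsum, mul_tsum_eq_one_of_entrywise hAG hsum hKN, fun x y => ?_⟩
  -- (135)
  obtain ⟨h0q, hq2⟩ := hνq x
  have hΦ : 0 ≤ (ν : ℝ) * (C₀ * Real.exp (3 * c * r)) * (P₀ x y * Real.exp (-(c / 2) * d x y)) :=
    mul_nonneg (mul_nonneg hν (mul_nonneg hC₀ (Real.exp_pos _).le))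
      (mul_nonneg (hP₀0 x y) (Real.exp_pos _).le)
  show ‖∑' n, (Gstar H G * Kop A H G ^ n) x y‖ ≤ _
  refine (norm_tsum_le_tsum_norm (hsumNorm x y)).trans ?_
  refine Real.tsum_le_of_sum_range_le (fun n => norm_nonneg _) fun N => ?_
  calc ∑ n ∈ range N, ‖(Gstar H G * Kop A H G ^ n) x y‖
      ≤ ∑ n ∈ range N, (ν : ℝ) * (C₀ * Real.exp (3 * c * r)) * (P₀ x y * Real.exp (-(c / 2) * d x y))
          * ((ν : ℝ) * q) ^ n := sum_le_sum fun n _ => hterm n x y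
    _ = (ν : ℝ) * (C₀ * Real.exp (3 * c * r)) * (P₀ x y * Real.exp (-(c / 2) * d x y))
          * ∑ n ∈ range N, ((ν : ℝ) * q) ^ n := by rw [mul_sum]
    _ ≤ (ν : ℝ) * (C₀ * Real.exp (3 * c * r)) * (P₀ x y * Real.exp (-(c / 2) * d x y))
          * ∑ n ∈ range N, (1 / 2 : ℝ) ^ n :=
        mul_le_mul_of_nonneg_left (sum_le_sum fun n _ => pow_le_pow_left₀ h0q hq2 n) hΦ
    _ ≤ (ν : ℝ) * (C₀ * Real.exp (3 * c * r)) * (P₀ x y * Real.exp (-(c / 2) * d x y)) * 2 :=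
        mul_le_mul_of_nonneg_left (sum_geometric_two_le N) hΦ
    _ = 2 * ν * (C₀ * Real.exp (3 * c * r)) * (P₀ x y * Real.exp (-(c / 2) * d x y)) := by ring

/-- **THEOREM 1 for commutative coefficients** (e.g. `E = ℂ` with the spinor index in the site type; the bosons): the
summed expansion is THE inverse — `A·S_{k,Λ}(A) = 1`, `S_{k,Λ}(A)·A = 1`, `A^{−1} = S_{k,Λ}(A)`, i.e. (119)
`S_{k,Λ}(A) = (D_{e_k}(A) + m_k + Q_{k,Λ}(−A)ᵀbQ_{k,Λ}(A))^{−1}_{L^{−k}Λ_0}`.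
[cite: Dimock2004QED3TorusII, §3.1 (119) p.20 L4–9 and §3.2 Thm 1 p.22 L12–21] -/
theorem dimock_thm1_comm {E : Type*} [NormedCommRing E] [NormedAlgebra ℝ E] [CompleteSpace E]
    {d P₀ Q : X → X → ℝ} {blk : X → B} {ctr : B → X} {c r θ : ℝ}
    (hθ : 0 ≤ θ) (hc : 0 ≤ c) (hQ0 : ∀ u v, 0 ≤ Q u v) (hP₀0 : ∀ u v, 0 ≤ P₀ u v)
    (hconv : ∀ (b : B) (u v : X),
      ∑ y ∈ univ.filter (fun u => blk u = b), (1 : ℝ) * (Q u y * Q y v) ≤ θ * Q u v)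
    (hconv₀ : ∀ (b : B) (u v : X),
      ∑ y ∈ univ.filter (fun u => blk u = b), (1 : ℝ) * (P₀ u y * Q y v) ≤ θ * P₀ u v)
    (hd0 : ∀ u v, 0 ≤ d u v) (hsymm : ∀ u v, d u v = d v u) (htri : ∀ u v t, d u t ≤ d u v + d v t)
    (hrad : ∀ u, d u (ctr (blk u)) ≤ r) {K : ℝ}
    (hK : ∀ b : B, ∑ b', Real.exp (-(c / 2) * d (ctr b) (ctr b')) ≤ K)
    (A : Matrix X X E) (H G : Z → Matrix X X E)
    (h125 : ∑ z, H z * H z = 1) (h136 : ∀ z, H z * A * G z = H z)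
    {C₀ C₁ M₀ : ℝ} (hC₀ : 0 ≤ C₀) (hC₁ : 0 ≤ C₁) (hM₀ : 0 < M₀)
    (h0 : ∀ z u v, ‖link0 H G z u v‖ ≤ C₀ * (P₀ u v * Real.exp (-(c * d u v))))
    (hR : ∀ z u v, ‖linkR A H G z u v‖ ≤ C₁ / M₀ * (Q u v * Real.exp (-(c * d u v))))
    (hadj : ∀ z z', ¬ adj z z' → H z * Kz A H z' = 0) {ν : ℕ}
    (hadjcard : ∀ z, (univ.filter fun z' => adj z z').card ≤ ν)
    (S₀ : X → Finset Z) (hS₀ : ∀ x, ∀ z ∉ S₀ x, ∀ v, link0 H G z x v = 0)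
    (hS₀card : ∀ x, (S₀ x).card ≤ ν)
    (S₁ : X → Finset Z) (hS₁ : ∀ x, ∀ z ∉ S₁ x, ∀ v, linkR A H G z x v = 0)
    (hS₁card : ∀ x, (S₁ x).card ≤ ν)
    (hlarge : 2 * ((ν : ℝ) * (C₁ * θ * K * Real.exp (2 * c * r))) ≤ M₀) :
    A * walkExpansion A H G = 1 ∧ walkExpansion A H G * A = 1 ∧ A⁻¹ = walkExpansion A H G := by
  obtain ⟨_, h2, _⟩ := dimock_thm1 adj hθ hc hQ0 hP₀0 hconv hconv₀ hd0 hsymm htri hrad hK A H G h125 h136 hC₀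
    hC₁ hM₀ h0 hR hadj hadjcard S₀ hS₀ hS₀card S₁ hS₁ hS₁card hlarge
  exact ⟨h2, mul_eq_one_comm.1 h2, Matrix.inv_eq_right_inv h2⟩

omit [DecidableEq X] [Fintype B] in
/-- **THEOREM 1's own profiles**: first link `P₀ = P` (`= d′^{−2}`), later links `Q(u,v) = lam(Δ_u)·P(u,v)` (the factor
`L^{k−i_j}` of (143) ∕ (153) attached to the block of the left variable); the SCALED (154) `lam(Δ)·Σ_{y∈Δ}P(u,y)P(y,v) ≤
θP(u,v)` (on `ℤ³`: the sibling file `QED3BackgroundFieldSeries`, `dimock154_L`, uniform in the scale) yields both block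
convolution hypotheses of `dimock_thm1`. [cite: Dimock2004QED3TorusII, §3.2 Thm 1 proof Part III (153)–(154) p.24 L76 – p.25 L3] -/
theorem profiles_of_scaled {P : X → X → ℝ} {lam : B → ℝ} (hlam : ∀ b, 0 ≤ lam b)
    (hconvL : ∀ (b : B) (u v : X),
      lam b * ∑ y ∈ univ.filter (fun u => blk u = b), (1 : ℝ) * (P u y * P y v) ≤ θ * P u v) :
    (∀ (b : B) (u v : X),
      ∑ y ∈ univ.filter (fun u => blk u = b), (1 : ℝ) * ((lam (blk u) * P u y) * (lam (blk y) * P y v))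
        ≤ θ * (lam (blk u) * P u v)) ∧
    (∀ (b : B) (u v : X),
      ∑ y ∈ univ.filter (fun u => blk u = b), (1 : ℝ) * (P u y * (lam (blk y) * P y v)) ≤ θ * P u v) := by
  have hmem : ∀ b, ∀ y ∈ univ.filter (fun u => blk u = b), blk y = b :=
    fun b y hy => (mem_filter.1 hy).2
  refine ⟨fun b u v => ?_, fun b u v => ?_⟩
  · calc ∑ y ∈ univ.filter (fun u => blk u = b), (1 : ℝ) * ((lam (blk u) * P u y) * (lam (blk y) * P y v))
        = lam (blk u) * (lam b * ∑ y ∈ univ.filter (fun u => blk u = b), (1 : ℝ) * (P u y * P y v)) := by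
          rw [mul_sum, mul_sum]
          refine sum_congr rfl fun y hy => ?_
          rw [hmem b y hy]; ring
      _ ≤ lam (blk u) * (θ * P u v) := mul_le_mul_of_nonneg_left (hconvL b u v) (hlam _)
      _ = θ * (lam (blk u) * P u v) := by ring
  · calc ∑ y ∈ univ.filter (fun u => blk u = b), (1 : ℝ) * (P u y * (lam (blk y) * P y v))
        = lam b * ∑ y ∈ univ.filter (fun u => blk u = b), (1 : ℝ) * (P u y * P y v) := by
          rw [mul_sum]
          refine sum_congr rfl fun y hy => ?_
          rw [hmem b y hy]; ring
      _ ≤ θ * P u v := hconvL b u v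

end Assembly

/-! ## §5 «In addition `S_{k,Λ,ω}(A)` and `S_{k,Λ}(A)` are gauge covariant» -/

section Gauge

variable {R : Type*} [Ring R] {Z : Type*}

/-- conjugation `a ↦ UaU⁻¹` by a gauge transformation `U` (an element with a two-sided inverse `Ui`; on the lattice, the
diagonal unitary `e^{ie_kλ(x)}`). [cite: Dimock2004QED3TorusII, §3.2 Thm 1 p.22 L22–23 («In addition `S_{k,Λ,ω}(A)` and `S_{k,Λ}(A,x,y)` are gauge covariant») with proof Part I p.23 L32–34 («The gauge covariance of `S_{k,Λ,ω}(A)` follows from that of `S*_□(A)` and `R_□(A)`»)] -/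
def gconj (U Ui a : R) : R := U * a * Ui

variable {U Ui : R}

/-- conjugation is multiplicative. [cite: Dimock2004QED3TorusII, §3.2 Thm 1 p.22 L22–23 («In addition `S_{k,Λ,ω}(A)` and `S_{k,Λ}(A,x,y)` are gauge covariant») with proof Part I p.23 L32–34 («The gauge covariance of `S_{k,Λ,ω}(A)` follows from that of `S*_□(A)` and `R_□(A)`»)] -/
theorem gconj_mul (hU : Ui * U = 1) (a b : R) : gconj U Ui (a * b) = gconj U Ui a * gconj U Ui b := by
  unfold gconj
  calc U * (a * b) * Ui = U * a * (Ui * U) * b * Ui := by rw [hU]; simp only [mul_one, mul_assoc]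
    _ = U * a * Ui * (U * b * Ui) := by simp only [mul_assoc]

/-- conjugation fixes `1`. [cite: Dimock2004QED3TorusII, §3.2 Thm 1 p.22 L22–23 («In addition `S_{k,Λ,ω}(A)` and `S_{k,Λ}(A,x,y)` are gauge covariant») with proof Part I p.23 L32–34 («The gauge covariance of `S_{k,Λ,ω}(A)` follows from that of `S*_□(A)` and `R_□(A)`»)] -/
theorem gconj_one (hU' : U * Ui = 1) : gconj U Ui (1 : R) = 1 := by
  unfold gconj; rw [mul_one, hU']

/-- conjugation is additive (differences). [cite: Dimock2004QED3TorusII, §3.2 Thm 1 p.22 L22–23 («In addition `S_{k,Λ,ω}(A)` and `S_{k,Λ}(A,x,y)` are gauge covariant») with proof Part I p.23 L32–34 («The gauge covariance of `S_{k,Λ,ω}(A)` follows from that of `S*_□(A)` and `R_□(A)`»)] -/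
theorem gconj_sub (a b : R) : gconj U Ui (a - b) = gconj U Ui a - gconj U Ui b := by
  unfold gconj; rw [mul_sub, sub_mul]

/-- conjugation commutes with finite sums. [cite: Dimock2004QED3TorusII, §3.2 Thm 1 p.22 L22–23 («In addition `S_{k,Λ,ω}(A)` and `S_{k,Λ}(A,x,y)` are gauge covariant») with proof Part I p.23 L32–34 («The gauge covariance of `S_{k,Λ,ω}(A)` follows from that of `S*_□(A)` and `R_□(A)`»)] -/
theorem gconj_sum [Fintype Z] (f : Z → R) : gconj U Ui (∑ z, f z) = ∑ z, gconj U Ui (f z) := by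
  unfold gconj; rw [mul_sum, sum_mul]

/-- conjugation commutes with powers. [cite: Dimock2004QED3TorusII, §3.2 Thm 1 p.22 L22–23 («In addition `S_{k,Λ,ω}(A)` and `S_{k,Λ}(A,x,y)` are gauge covariant») with proof Part I p.23 L32–34 («The gauge covariance of `S_{k,Λ,ω}(A)` follows from that of `S*_□(A)` and `R_□(A)`»)] -/
theorem gconj_pow (hU : Ui * U = 1) (hU' : U * Ui = 1) (a : R) : ∀ n : ℕ, gconj U Ui (a ^ n) = gconj U Ui a ^ n
  | 0 => by rw [pow_zero, pow_zero, gconj_one hU']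
  | n + 1 => by rw [pow_succ, gconj_mul hU, gconj_pow hU hU' a n, pow_succ]

/-- conjugation commutes with ordered products. [cite: Dimock2004QED3TorusII, §3.2 Thm 1 p.22 L22–23 («In addition `S_{k,Λ,ω}(A)` and `S_{k,Λ}(A,x,y)` are gauge covariant») with proof Part I p.23 L32–34 («The gauge covariance of `S_{k,Λ,ω}(A)` follows from that of `S*_□(A)` and `R_□(A)`»)] -/
theorem gconj_listProd (hU : Ui * U = 1) (hU' : U * Ui = 1) :
    ∀ {n : ℕ} (f : Fin n → R), gconj U Ui (List.ofFn f).prod = (List.ofFn fun j => gconj U Ui (f j)).prod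
  | 0, f => by simp [gconj_one hU']
  | n + 1, f => by
      rw [List.ofFn_succ, List.prod_cons, List.ofFn_succ, List.prod_cons, gconj_mul hU, gconj_listProd hU hU']

variable {A : R} {H G G' : Z → R}

/-- **`R_□` is gauge covariant**: if the operator transforms as `A ↦ UAU⁻¹` and `h_□` commutes with `U`
(`Uh_□U⁻¹ = h_□`), then `R_□(UAU⁻¹) = UR_□(A)U⁻¹`. [cite: Dimock2004QED3TorusII, §3.2 Thm 1 p.22 L22–23 («In addition `S_{k,Λ,ω}(A)` and `S_{k,Λ}(A,x,y)` are gauge covariant») with proof Part I p.23 L32–34 («The gauge covariance of `S_{k,Λ,ω}(A)` follows from that of `S*_□(A)` and `R_□(A)`»)] -/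
theorem Kz_gconj (hH : ∀ z, gconj U Ui (H z) = H z) (hU : Ui * U = 1) (z : Z) :
    Kz (gconj U Ui A) H z = gconj U Ui (Kz A H z) := by
  unfold Kz
  rw [gconj_sub, gconj_mul hU, gconj_mul hU, hH]

/-- the first link is covariant when `S*_□` is (`S*_□(A^U) = US*_□(A)U⁻¹`, LEMMA 2). [cite: Dimock2004QED3TorusII, §3.2 Thm 1 p.22 L22–23 («In addition `S_{k,Λ,ω}(A)` and `S_{k,Λ}(A,x,y)` are gauge covariant») with proof Part I p.23 L32–34 («The gauge covariance of `S_{k,Λ,ω}(A)` follows from that of `S*_□(A)` and `R_□(A)`»)] -/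
theorem link0_gconj (hH : ∀ z, gconj U Ui (H z) = H z) (hG : ∀ z, G' z = gconj U Ui (G z)) (hU : Ui * U = 1)
    (z : Z) : link0 H G' z = gconj U Ui (link0 H G z) := by
  unfold link0
  rw [gconj_mul hU, gconj_mul hU, hH, hG]

/-- the later links are covariant. [cite: Dimock2004QED3TorusII, §3.2 Thm 1 p.22 L22–23 («In addition `S_{k,Λ,ω}(A)` and `S_{k,Λ}(A,x,y)` are gauge covariant») with proof Part I p.23 L32–34 («The gauge covariance of `S_{k,Λ,ω}(A)` follows from that of `S*_□(A)` and `R_□(A)`»)] -/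
theorem linkR_gconj (hH : ∀ z, gconj U Ui (H z) = H z) (hG : ∀ z, G' z = gconj U Ui (G z)) (hU : Ui * U = 1)
    (z : Z) : linkR (gconj U Ui A) H G' z = gconj U Ui (linkR A H G z) := by
  unfold linkR
  rw [gconj_mul hU, gconj_mul hU, hH, hG, Kz_gconj hH hU]

/-- **each path term `S_{k,Λ,ω}(A)` is gauge covariant.** [cite: Dimock2004QED3TorusII, §3.2 Thm 1 p.22 L22–23 («In addition `S_{k,Λ,ω}(A)` and `S_{k,Λ}(A,x,y)` are gauge covariant») with proof Part I p.23 L32–34 («The gauge covariance of `S_{k,Λ,ω}(A)` follows from that of `S*_□(A)` and `R_□(A)`»)] -/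
theorem walkTerm_gconj (hH : ∀ z, gconj U Ui (H z) = H z) (hG : ∀ z, G' z = gconj U Ui (G z))
    (hU : Ui * U = 1) (hU' : U * Ui = 1) (z₀ : Z) {n : ℕ} (ω : Fin n → Z) :
    walkTerm (gconj U Ui A) H G' z₀ ω = gconj U Ui (walkTerm A H G z₀ ω) := by
  have e : (fun j => linkR (gconj U Ui A) H G' (ω j)) = fun j => gconj U Ui (linkR A H G (ω j)) :=
    funext fun j => linkR_gconj hH hG hU _
  rw [walkTerm_eq, walkTerm_eq, gconj_mul hU, link0_gconj hH hG hU, gconj_listProd hU hU', e]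

variable [Fintype Z]

/-- the parametrix `S*(A)` is covariant. [cite: Dimock2004QED3TorusII, §3.2 Thm 1 p.22 L22–23 («In addition `S_{k,Λ,ω}(A)` and `S_{k,Λ}(A,x,y)` are gauge covariant») with proof Part I p.23 L32–34 («The gauge covariance of `S_{k,Λ,ω}(A)` follows from that of `S*_□(A)` and `R_□(A)`»)] -/
theorem Gstar_gconj (hH : ∀ z, gconj U Ui (H z) = H z) (hG : ∀ z, G' z = gconj U Ui (G z)) (hU : Ui * U = 1) :
    Gstar H G' = gconj U Ui (Gstar H G) := by
  unfold Gstar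
  rw [gconj_sum]
  exact sum_congr rfl fun z _ => by rw [gconj_mul hU, gconj_mul hU, hH, hG]

/-- `R = Σ_□R_□S*_□h_□` is covariant. [cite: Dimock2004QED3TorusII, §3.2 Thm 1 p.22 L22–23 («In addition `S_{k,Λ,ω}(A)` and `S_{k,Λ}(A,x,y)` are gauge covariant») with proof Part I p.23 L32–34 («The gauge covariance of `S_{k,Λ,ω}(A)` follows from that of `S*_□(A)` and `R_□(A)`»)] -/
theorem Kop_gconj (hH : ∀ z, gconj U Ui (H z) = H z) (hG : ∀ z, G' z = gconj U Ui (G z)) (hU : Ui * U = 1) :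
    Kop (gconj U Ui A) H G' = gconj U Ui (Kop A H G) := by
  unfold Kop
  rw [gconj_sum]
  exact sum_congr rfl fun z _ => by rw [gconj_mul hU, gconj_mul hU, hH, hG, Kz_gconj hH hU]

/-- the `n`-link part `S*(A)R^n` is covariant. [cite: Dimock2004QED3TorusII, §3.2 Thm 1 p.22 L22–23 («In addition `S_{k,Λ,ω}(A)` and `S_{k,Λ}(A,x,y)` are gauge covariant») with proof Part I p.23 L32–34 («The gauge covariance of `S_{k,Λ,ω}(A)` follows from that of `S*_□(A)` and `R_□(A)`»)] -/
theorem Gstar_mul_Kop_pow_gconj (hH : ∀ z, gconj U Ui (H z) = H z) (hG : ∀ z, G' z = gconj U Ui (G z))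
    (hU : Ui * U = 1) (hU' : U * Ui = 1) (n : ℕ) :
    Gstar H G' * Kop (gconj U Ui A) H G' ^ n = gconj U Ui (Gstar H G * Kop A H G ^ n) := by
  rw [Gstar_gconj hH hG hU, Kop_gconj hH hG hU, ← gconj_pow hU hU', ← gconj_mul hU]

end Gauge

section GaugeSum

variable {X : Type*} [Fintype X] [DecidableEq X] {E : Type*} [NormedRing E]
variable {Z : Type*} [Fintype Z]

/-- **`S_{k,Λ}(A)` is gauge covariant**: `S_{k,Λ}(UAU⁻¹)` built from the covariantly transformed local inverses equals
`US_{k,Λ}(A)U⁻¹` (entrywise sums; summability as delivered by `dimock_thm1`). [cite: Dimock2004QED3TorusII, §3.2 Thm 1 p.22 L22–23 («In addition `S_{k,Λ,ω}(A)` and `S_{k,Λ}(A,x,y)` are gauge covariant») with proof Part I p.23 L32–34 («The gauge covariance of `S_{k,Λ,ω}(A)` follows from that of `S*_□(A)` and `R_□(A)`»)] -/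
theorem walkExpansion_gconj {U Ui A : Matrix X X E} {H G G' : Z → Matrix X X E}
    (hH : ∀ z, gconj U Ui (H z) = H z) (hG : ∀ z, G' z = gconj U Ui (G z)) (hU : Ui * U = 1) (hU' : U * Ui = 1)
    (hsum : ∀ x y, Summable fun n => (Gstar H G * Kop A H G ^ n) x y) :
    walkExpansion (gconj U Ui A) H G' = gconj U Ui (walkExpansion A H G) := by
  have e : ∀ n, Gstar H G' * Kop (gconj U Ui A) H G' ^ n = U * (Gstar H G * Kop A H G ^ n) * Ui :=
    fun n => Gstar_mul_Kop_pow_gconj hH hG hU hU' n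
  have hT : HasSum (fun n => Gstar H G * Kop A H G ^ n) (walkExpansion A H G) :=
    Pi.hasSum.2 fun x => Pi.hasSum.2 fun y => by
      show HasSum (fun n => (Gstar H G * Kop A H G ^ n) x y) (∑' n, (Gstar H G * Kop A H G ^ n) x y)
      exact (hsum x y).hasSum
  have hT' : HasSum (fun n => U * (Gstar H G * Kop A H G ^ n) * Ui) (U * walkExpansion A H G * Ui) :=
    (hT.mul_left U).mul_right Ui
  ext x y
  have hxy : HasSum (fun n => (U * (Gstar H G * Kop A H G ^ n) * Ui) x y)
      ((U * walkExpansion A H G * Ui) x y) := Pi.hasSum.1 (Pi.hasSum.1 hT' x) y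
  show (∑' n, (Gstar H G' * Kop (gconj U Ui A) H G' ^ n) x y) = (U * walkExpansion A H G * Ui) x y
  simp_rw [e]
  exact hxy.tsum_eq

end GaugeSum

end QED3TorusII

end Literature.MathematicalPhysics.QuantumFieldTheory.Dimock2011to13
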